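import Literature.NumberTheory.Automorphic.ArchMaximalCompactGeneratorsGL2
import Literature.NumberTheory.Automorphic.ArchKirillovBaseVectorNormalFormGL2
import Literature.NumberTheory.Automorphic.ArchGardingFiniteDimStable
import Literature.NumberTheory.Automorphic.ArchWhittakerRieszVectors
import Literature.NumberTheory.Automorphic.ArchUnipotentSmoothingGL2
import Literature.NumberTheory.Automorphic.ArchTorusCoordinatesGL2
import Literature.NumberTheory.Automorphic.IwasawaDecompositionArchimedean
import HarnessLib

/-!
# The Kirillov map of `GL₂(K_∞)` is injective on `K_∞`-finite vectors
# (Jacquet–Langlands (1970), §5 Prop. 5.? / §6: the Kirillov model; Jacquet–Shalika (1981), §3)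

Topic `NumberTheory/Automorphic`; namespace `Literature.NumberTheory.Automorphic`. Theorems only (no
definition, no named fact, no instance). Let `τ` be an irreducible unitary strongly continuous
representation of `G_∞ = GL₂(K_∞)` on a Hilbert space `E`, `𝒢` its Gårding space, `ℓ ≠ 0` a continuous
`ψ_∞`-Whittaker functional and `S_ℓ = kirillovNull hτ ℓ` the null space of the Kirillov map
`v ↦ (u ↦ ℓ(τ(diag(u,1)) v))`. We prove

  **`v ∈ S_ℓ`, `v` `K_∞`-finite  ⟹  `v = 0`**   (`eq_zero_of_kFinite_of_mem_kirillovNull`),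

i.e. the Kirillov model is a model on the `K_∞`-finite vectors (Jacquet–Langlands (1970), §5–§6 prove much
more: on all smooth vectors). The argument:

1. `S_ℓ ∩ V` is `K_∞`-stable for `V` finite-dimensional and `K_∞`-stable (`kirillovNull_inf_kStable`):
   it is finite-dimensional and stable under `τ(X)`, `X ∈ 𝔨` (`S_ℓ` is a `U(𝔤)`-module,
   `ArchKirillovNullSpaceGL2`; `V` by differentiating the `K_∞`-action), hence under `exp(𝔨)`
   (`ArchGardingFiniteDimStable`), and under the signs `δ_w` (torus elements) — and these generate `K_∞`
   (`ArchMaximalCompactGeneratorsGL2.Kinf_induction`).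
2. `S_ℓ` is stable under the Borel subgroup: unipotents act through `ψ_∞`, the centre by scalars (Schur),
   the torus `diag(u,1)` by translation (`gardingAct_borel_mem_kirillovNull`).
3. Iwasawa `G_∞ = B K_∞` (`IwasawaDecompositionArchimedean`, place by place and reassembled:
   `exists_borel_mul_Kinf`); so the whole Whittaker function `g ↦ ℓ(τ(g) v)` of such a `v` vanishes.
4. A Gårding vector whose Whittaker function vanishes identically is `0`
   (`eq_zero_of_forall_apply_gardingAct_eq_zero`): the Riesz vectors `ξ_α` of `ℓ`
   (`ArchWhittakerRieszVectors`) are then orthogonal to the closed span of `τ(G_∞) v`, which is all of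
   `E` by irreducibility unless `v = 0`; but `ξ_α ≠ 0` for some `α` since `ℓ ≠ 0`.

## References

* H. Jacquet, R. P. Langlands, *Automorphic Forms on GL(2)*, LNM 114 (1970), §5 (Prop. 5.? — the Kirillov
  model of `GL₂(ℝ)`), §6 (`GL₂(ℂ)`). [JacquetLanglands1970]
* H. Jacquet, J. A. Shalika, *On Euler products and the classification of automorphic representations I*,
  Amer. J. Math. 103 (1981), §3 (3.8). [JacquetShalikaAJM1981]
* A. W. Knapp, *Representation Theory of Semisimple Groups* (1986), Ch. I §1, Ch. VIII §2. [Knapp1986]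
-/

noncomputable section

open MeasureTheory Measure NumberField NumberField.InfinitePlace NumberField.mixedEmbedding IsDedekindDomain Set Filter
open scoped MatrixGroups Topology Classical InnerProductSpace

namespace Literature.NumberTheory.Automorphic

variable {K : Type} [Field K] [NumberField K]

-- as in `ArchGardingWhittaker`
set_option backward.isDefEq.respectTransparency false

attribute [local instance] glInfBorel borelSpace_glInf locallyCompactSpace_glInf secondCountableTopology_glInf

/-! ### 1. `S_ℓ ∩ V` is `K_∞`-stable -/

section KStable

variable {hcpt : isCompact_glFiniteIntegralLevel 2 K}
  {E : Type*} [NormedAddCommGroup E] [InnerProductSpace ℂ E] [CompleteSpace E]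
  {τ : ContRepresentation ℂ (AutomorphyDatum.gl 2 K hcpt).arch.carrier E}
  (hτ : τ.IsStronglyContinuous)

/-- **`S_ℓ ∩ V` is `K_∞`-stable** for `V` a finite-dimensional `K_∞`-stable subspace of the Gårding space
(`τ` irreducible unitary): it is stable under `τ(X)` for skew-hermitian `X` (`S_ℓ` is a `U(𝔤)`-module;
`V` by `gardingEnd_mem_of_kStable`), hence under `exp X` (`gardingAct_expGL_mem_of_gardingEnd_mem`), and
under the signs `δ_w = diag(-1_w, 1)`; these generate `K_∞` (`Kinf_induction`).
[cite: JacquetLanglands1970, §5–§6] [cite: Knapp1986, Ch. VIII §2] -/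
theorem kirillovNull_inf_kStable (hτu : τ.IsUnitary) (hτi : τ.IsTopIrreducible)
    {ℓ : archGardingSpace hcpt τ →ₗ[ℂ] ℂ} (hℓW : IsArchContWhittakerFunctional hcpt τ hτ ℓ)
    {V : Submodule ℂ (archGardingSpace hcpt τ)} [FiniteDimensional ℂ V]
    (hK : ∀ κ ∈ Kinf 2 K, ∀ u ∈ V, gardingAct hτ κ u ∈ V)
    {κ : GL (Fin 2) (mixedSpace K)} (hκ : κ ∈ Kinf 2 K) {u : archGardingSpace hcpt τ}
    (hu : u ∈ kirillovNull hτ ℓ ⊓ V) : gardingAct hτ κ u ∈ kirillovNull hτ ℓ ⊓ V := by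
  haveI : FiniteDimensional ℂ ↥(kirillovNull hτ ℓ ⊓ V) := Submodule.finiteDimensional_of_le inf_le_right
  refine Kinf_induction K (P := fun g => ∀ u ∈ kirillovNull hτ ℓ ⊓ V, gardingAct hτ g u ∈ kirillovNull hτ ℓ ⊓ V)
    (fun u hu => by rwa [gardingAct_one, Module.End.one_apply]) (fun g h hg hh u hu => ?_) (fun X hX u hu => ?_)
    (fun w δ hδ u hu => ?_) hκ u hu
  · rw [gardingAct_mul, Module.End.mul_apply]
    exact hg _ (hh _ hu)
  · have hXst : ∀ v ∈ kirillovNull hτ ℓ ⊓ V, gardingEnd hτ X v ∈ kirillovNull hτ ℓ ⊓ V := fun v hv =>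
      ⟨gardingEnd_mem_kirillovNull_of_isUnitary hτ hτu hτi hℓW X hv.1, gardingEnd_mem_of_kStable hτ hK hX hv.2⟩
    have h := gardingAct_expGL_mem_of_gardingEnd_mem hτ hXst 1 hu
    rwa [one_smul] at h
  · exact ⟨gardingAct_mem_kirillovNull_of_eq_diagGL2 hτ ℓ (realSign_eq_diagGL2 hδ) hu.1,
      hK δ (realSign_mem_Kinf hδ) u hu.2⟩

end KStable

/-! ### 2. `S_ℓ` is stable under the Borel subgroup -/

section Borel

variable {hcpt : isCompact_glFiniteIntegralLevel 2 K}
  {E : Type*} [NormedAddCommGroup E] [InnerProductSpace ℂ E] [CompleteSpace E]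
  {τ : ContRepresentation ℂ (AutomorphyDatum.gl 2 K hcpt).arch.carrier E}
  (hτ : τ.IsStronglyContinuous)

/-- `S_ℓ` is stable under the unipotent `n(x)`: `diag(u,1) n(x) = n(ux) diag(u,1)` and
`ℓ(τ(n) y) = ψ_∞(n) ℓ(y)`. [cite: JacquetShalikaAJM1981, §3] -/
theorem gardingAct_unipotentGL2_mem_kirillovNull {ℓ : archGardingSpace hcpt τ →ₗ[ℂ] ℂ}
    (hℓW : IsArchContWhittakerFunctional hcpt τ hτ ℓ) (x : mixedSpace K) {v : archGardingSpace hcpt τ}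
    (hv : v ∈ kirillovNull hτ ℓ) :
    gardingAct hτ ((unipotentGL2 x : ↥(upperUnitriangular (Fin 2) (mixedSpace K))) : GL (Fin 2) (mixedSpace K)) v ∈ kirillovNull hτ ℓ := by
  rw [mem_kirillovNull_iff] at hv ⊢
  intro u
  have hconj : diagGL2 u 1 * ((unipotentGL2 x : ↥(upperUnitriangular (Fin 2) (mixedSpace K))) : GL (Fin 2) (mixedSpace K)) =
      ((unipotentGL2 ((u : mixedSpace K) * x) : ↥(upperUnitriangular (Fin 2) (mixedSpace K))) : GL (Fin 2) (mixedSpace K)) * diagGL2 u 1 := by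
    rw [← diagGL2_mul_unipotentGL2_mul_inv u x, inv_mul_cancel_right]
  rw [← Module.End.mul_apply, ← gardingAct_mul, hconj, gardingAct_mul, Module.End.mul_apply]
  have h := hℓW.map_unipotent (unipotentGL2 ((u : mixedSpace K) * x)) (gardingAct hτ (diagGL2 u 1) v)
  rw [hv u, mul_zero] at h
  have e : gardingAct hτ ((unipotentGL2 ((u : mixedSpace K) * x) : ↥(upperUnitriangular (Fin 2) (mixedSpace K))) : GL (Fin 2) (mixedSpace K))
      (gardingAct hτ (diagGL2 u 1) v) = ⟨τ (toArch hcpt ((unipotentGL2 ((u : mixedSpace K) * x) :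
        ↥(upperUnitriangular (Fin 2) (mixedSpace K))) : GL (Fin 2) (mixedSpace K))) (gardingAct hτ (diagGL2 u 1) v),
        apply_mem_archGardingSpace hτ _ (gardingAct hτ (diagGL2 u 1) v).2⟩ := Subtype.ext (coe_gardingAct_apply hτ _ _)
  rw [e]
  exact h

/-- The centre `diag(z, z)` acts on `E` by a scalar (Schur's lemma for the irreducible unitary `τ`), hence
preserves `S_ℓ`. [cite: Knapp1986, Ch. VIII §3] -/
theorem exists_gardingAct_diagGL2_self_eq_smul (hτu : τ.IsUnitary) (hτi : τ.IsTopIrreducible) (z : (mixedSpace K)ˣ) :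
    ∃ c : ℂ, ∀ v : archGardingSpace hcpt τ, gardingAct hτ (diagGL2 z z) v = c • v := by
  have hT : ∀ g : (AutomorphyDatum.gl 2 K hcpt).arch.carrier, Commute (τ g : E →L[ℂ] E) (τ (toArch hcpt (diagGL2 z z))) := by
    intro g
    change τ g * τ (toArch hcpt (diagGL2 z z)) = τ (toArch hcpt (diagGL2 z z)) * τ g
    rw [← map_mul, ← map_mul]
    congr 1
    refine Subtype.ext (Units.ext ?_)
    change ((g : GL (Fin 2) (mixedSpace K)) : Matrix (Fin 2) (Fin 2) (mixedSpace K)) * ((diagGL2 z z : GL (Fin 2) (mixedSpace K)) : Matrix (Fin 2) (Fin 2) (mixedSpace K)) =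
      ((diagGL2 z z : GL (Fin 2) (mixedSpace K)) : Matrix (Fin 2) (Fin 2) (mixedSpace K)) * ((g : GL (Fin 2) (mixedSpace K)) : Matrix (Fin 2) (Fin 2) (mixedSpace K))
    have hz : ((diagGL2 z z : GL (Fin 2) (mixedSpace K)) : Matrix (Fin 2) (Fin 2) (mixedSpace K)) = (z : mixedSpace K) • (1 : Matrix (Fin 2) (Fin 2) (mixedSpace K)) := by
      rw [coe_diagGL2]
      refine Matrix.ext fun i j => ?_
      fin_cases i <;> fin_cases j <;> simp
    rw [hz, Matrix.mul_smul, Matrix.mul_one, Matrix.smul_mul, Matrix.one_mul]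
  obtain ⟨c, hc⟩ := hτi.exists_apply_eq_smul_of_commute hτu hT
  exact ⟨c, fun v => Subtype.ext (by rw [coe_gardingAct_apply, hc, Submodule.coe_smul])⟩

/-- **`S_ℓ` is stable under the Borel subgroup**: an upper triangular `p ∈ GL₂(K_∞)` is
`n(x) · diag(z,z) · diag(u,1)`. [cite: JacquetShalikaAJM1981, §3] -/
theorem gardingAct_borel_mem_kirillovNull (hτu : τ.IsUnitary) (hτi : τ.IsTopIrreducible)
    {ℓ : archGardingSpace hcpt τ →ₗ[ℂ] ℂ} (hℓW : IsArchContWhittakerFunctional hcpt τ hτ ℓ)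
    {p : GL (Fin 2) (mixedSpace K)} (hp : (p : Matrix (Fin 2) (Fin 2) (mixedSpace K)) 1 0 = 0)
    {v : archGardingSpace hcpt τ} (hv : v ∈ kirillovNull hτ ℓ) : gardingAct hτ p v ∈ kirillovNull hτ ℓ := by
  -- the diagonal entries are units
  have hdet : IsUnit ((p : Matrix (Fin 2) (Fin 2) (mixedSpace K)) 0 0 * (p : Matrix (Fin 2) (Fin 2) (mixedSpace K)) 1 1) := by
    have h := (Matrix.isUnit_iff_isUnit_det _).1 p.isUnit
    rw [Matrix.det_fin_two, hp, mul_zero, sub_zero] at h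
    exact h
  obtain ⟨ha, hd⟩ := IsUnit.mul_iff.1 hdet
  set a := ha.unit with ha'
  set d := hd.unit with hd'
  set x : mixedSpace K := (p : Matrix (Fin 2) (Fin 2) (mixedSpace K)) 0 1 * ↑d⁻¹ with hx
  have h00 : (d : mixedSpace K) * ((a : mixedSpace K) * ((d⁻¹ : (mixedSpace K)ˣ) : mixedSpace K)) = (p : Matrix (Fin 2) (Fin 2) (mixedSpace K)) 0 0 := by
    rw [mul_left_comm, Units.mul_inv, mul_one]; exact ha.unit_spec
  have h01 : x * (d : mixedSpace K) = (p : Matrix (Fin 2) (Fin 2) (mixedSpace K)) 0 1 := by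
    rw [hx, mul_assoc, Units.inv_mul, mul_one]
  have h11 : (d : mixedSpace K) = (p : Matrix (Fin 2) (Fin 2) (mixedSpace K)) 1 1 := hd.unit_spec
  have hpeq : p = ((unipotentGL2 x : ↥(upperUnitriangular (Fin 2) (mixedSpace K))) : GL (Fin 2) (mixedSpace K)) * diagGL2 d d * diagGL2 (a * d⁻¹) 1 := by
    refine Units.ext ?_
    rw [Units.val_mul, Units.val_mul, coe_unipotentGL2, coe_diagGL2, coe_diagGL2]
    refine Matrix.ext fun i j => ?_
    fin_cases i <;> fin_cases j
    · simpa [Matrix.mul_apply, Fin.sum_univ_two, -Units.val_inv_eq_inv_val] using h00.symm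
    · simpa [Matrix.mul_apply, Fin.sum_univ_two, -Units.val_inv_eq_inv_val] using h01.symm
    · simp [Matrix.mul_apply, Fin.sum_univ_two, hp]
    · simpa [Matrix.mul_apply, Fin.sum_univ_two, -Units.val_inv_eq_inv_val] using h11.symm
  obtain ⟨c, hc⟩ := exists_gardingAct_diagGL2_self_eq_smul hτ hτu hτi d
  rw [hpeq, gardingAct_mul, gardingAct_mul, Module.End.mul_apply, Module.End.mul_apply, hc]
  exact gardingAct_unipotentGL2_mem_kirillovNull hτ hℓW x (Submodule.smul_mem _ c (gardingAct_diagGL2_mem_kirillovNull hτ ℓ _ hv))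

end Borel

/-! ### 3. Iwasawa `G_∞ = B · K_∞` -/

section Iwasawa

omit [NumberField K] in
/-- A `GL₂(K_∞)`-element with prescribed place components. [folklore] -/
theorem exists_gl_of_components (bR : {w : InfinitePlace K // IsReal w} → GL (Fin 2) ℝ)
    (bC : {w : InfinitePlace K // IsComplex w} → GL (Fin 2) ℂ) [NumberField K] :
    ∃ B : GL (Fin 2) (mixedSpace K),
      (∀ v, (mixedSpaceEvalReal K v).mapMatrix (B : Matrix (Fin 2) (Fin 2) (mixedSpace K)) = (bR v : Matrix (Fin 2) (Fin 2) ℝ)) ∧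
      (∀ v, (mixedSpaceEvalComplex K v).mapMatrix (B : Matrix (Fin 2) (Fin 2) (mixedSpace K)) = (bC v : Matrix (Fin 2) (Fin 2) ℂ)) := by
  have stepR : ∀ T : Finset {w : InfinitePlace K // IsReal w}, ∃ g : GL (Fin 2) (mixedSpace K),
      (∀ v, (mixedSpaceEvalReal K v).mapMatrix (g : Matrix (Fin 2) (Fin 2) (mixedSpace K)) =
        if v ∈ T then ((bR v : GL (Fin 2) ℝ) : Matrix (Fin 2) (Fin 2) ℝ) else 1) ∧
      (∀ v, (mixedSpaceEvalComplex K v).mapMatrix (g : Matrix (Fin 2) (Fin 2) (mixedSpace K)) = 1) := by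
    intro T
    induction T using Finset.induction_on with
    | empty => exact ⟨1, fun v => by simp, fun v => by simp⟩
    | @insert w T hw ih =>
      obtain ⟨g, hgR, hgC⟩ := ih
      refine ⟨g * realPlaceGL K w (bR w), fun v => ?_, fun v => ?_⟩
      · rw [Units.val_mul, map_mul, hgR v, evalReal_coe_realPlaceGL]
        by_cases hv : v = w
        · subst hv
          rw [if_neg hw, if_pos rfl, if_pos (Finset.mem_insert_self _ _), one_mul]
        · rw [if_neg hv, mul_one]
          by_cases hvT : v ∈ T
          · rw [if_pos hvT, if_pos (Finset.mem_insert_of_mem hvT)]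
          · rw [if_neg hvT, if_neg (by rw [Finset.mem_insert]; push Not; exact ⟨hv, hvT⟩)]
      · rw [Units.val_mul, map_mul, hgC v, evalComplex_coe_realPlaceGL, one_mul]
  obtain ⟨g₀, hg₀R, hg₀C⟩ := stepR Finset.univ
  have stepC : ∀ T : Finset {w : InfinitePlace K // IsComplex w}, ∃ g : GL (Fin 2) (mixedSpace K),
      (∀ v, (mixedSpaceEvalReal K v).mapMatrix (g : Matrix (Fin 2) (Fin 2) (mixedSpace K)) = (bR v : Matrix (Fin 2) (Fin 2) ℝ)) ∧
      (∀ v, (mixedSpaceEvalComplex K v).mapMatrix (g : Matrix (Fin 2) (Fin 2) (mixedSpace K)) =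
        if v ∈ T then ((bC v : GL (Fin 2) ℂ) : Matrix (Fin 2) (Fin 2) ℂ) else 1) := by
    intro T
    induction T using Finset.induction_on with
    | empty => exact ⟨g₀, fun v => by rw [hg₀R v, if_pos (Finset.mem_univ _)], fun v => by rw [hg₀C v]; simp⟩
    | @insert w T hw ih =>
      obtain ⟨g, hgR, hgC⟩ := ih
      refine ⟨g * complexPlaceGL K w (bC w), fun v => ?_, fun v => ?_⟩
      · rw [Units.val_mul, map_mul, hgR v, evalReal_coe_complexPlaceGL, mul_one]
      · rw [Units.val_mul, map_mul, hgC v, evalComplex_coe_complexPlaceGL]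
        by_cases hv : v = w
        · subst hv
          rw [if_neg hw, if_pos rfl, if_pos (Finset.mem_insert_self _ _), one_mul]
        · rw [if_neg hv, mul_one]
          by_cases hvT : v ∈ T
          · rw [if_pos hvT, if_pos (Finset.mem_insert_of_mem hvT)]
          · rw [if_neg hvT, if_neg (by rw [Finset.mem_insert]; push Not; exact ⟨hv, hvT⟩)]
  obtain ⟨g, hgR, hgC⟩ := stepC Finset.univ
  exact ⟨g, hgR, fun v => by rw [hgC v, if_pos (Finset.mem_univ _)]⟩

/-- **Iwasawa decomposition of `GL₂(K_∞)`**: `g = p κ` with `p` upper triangular and `κ ∈ K_∞`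
(Gram–Schmidt at each place, `IwasawaDecompositionArchimedean`, reassembled over the places).
[cite: Knapp1986, Ch. V §2] -/
theorem exists_borel_mul_Kinf (g : GL (Fin 2) (mixedSpace K)) :
    ∃ (p κ : GL (Fin 2) (mixedSpace K)), (p : Matrix (Fin 2) (Fin 2) (mixedSpace K)) 1 0 = 0 ∧ κ ∈ Kinf 2 K ∧ g = p * κ := by
  -- place by place
  have hR : ∀ w : {w : InfinitePlace K // IsReal w}, ∃ (b k : GL (Fin 2) ℝ), (b : Matrix (Fin 2) (Fin 2) ℝ) 1 0 = 0 ∧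
      (k : Matrix (Fin 2) (Fin 2) ℝ) ∈ Matrix.unitaryGroup (Fin 2) ℝ ∧ Matrix.GeneralLinearGroup.map (mixedSpaceEvalReal K w) g = b * k := by
    intro w
    obtain ⟨b, k, d, hb, -, -, hk, hgbk⟩ := Matrix.GeneralLinearGroup.exists_upperTriangularPos_mul_unitary
      (Matrix.GeneralLinearGroup.map (mixedSpaceEvalReal K w) g)
    exact ⟨b, k, hb (show id (0 : Fin 2) < id 1 by decide), hk, hgbk⟩
  have hC : ∀ w : {w : InfinitePlace K // IsComplex w}, ∃ (b k : GL (Fin 2) ℂ), (b : Matrix (Fin 2) (Fin 2) ℂ) 1 0 = 0 ∧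
      (k : Matrix (Fin 2) (Fin 2) ℂ) ∈ Matrix.unitaryGroup (Fin 2) ℂ ∧ Matrix.GeneralLinearGroup.map (mixedSpaceEvalComplex K w) g = b * k := by
    intro w
    obtain ⟨b, k, d, hb, -, -, hk, hgbk⟩ := Matrix.GeneralLinearGroup.exists_upperTriangularPos_mul_unitary
      (Matrix.GeneralLinearGroup.map (mixedSpaceEvalComplex K w) g)
    exact ⟨b, k, hb (show id (0 : Fin 2) < id 1 by decide), hk, hgbk⟩
  choose bR kR hbR hkR hgR using hR
  choose bC kC hbC hkC hgC using hC
  obtain ⟨P, hPR, hPC⟩ := exists_gl_of_components (K := K) bR bC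
  obtain ⟨Kel, hKR, hKC⟩ := exists_gl_of_components (K := K) kR kC
  refine ⟨P, Kel, ?_, ?_, ?_⟩
  · refine Prod.ext (funext fun v => ?_) (funext fun v => ?_)
    · have h := congrFun (congrFun (hPR v) 1) 0
      rw [RingHom.mapMatrix_apply, Matrix.map_apply, hbR v] at h
      exact h
    · have h := congrFun (congrFun (hPC v) 1) 0
      rw [RingHom.mapMatrix_apply, Matrix.map_apply, hbC v] at h
      exact h
  · rw [mem_Kinf_iff]
    refine ⟨fun v => ?_, fun v => ?_⟩
    · rw [mem_unitarySubgroupGL_iff_coe_mem_unitaryGroup]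
      have h : ((Matrix.GeneralLinearGroup.map (mixedSpaceEvalReal K v) Kel : GL (Fin 2) ℝ) : Matrix (Fin 2) (Fin 2) ℝ) =
          (kR v : Matrix (Fin 2) (Fin 2) ℝ) := hKR v
      rw [h]; exact hkR v
    · rw [mem_unitarySubgroupGL_iff_coe_mem_unitaryGroup]
      have h : ((Matrix.GeneralLinearGroup.map (mixedSpaceEvalComplex K v) Kel : GL (Fin 2) ℂ) : Matrix (Fin 2) (Fin 2) ℂ) =
          (kC v : Matrix (Fin 2) (Fin 2) ℂ) := hKC v
      rw [h]; exact hkC v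
  · refine Units.ext (matrix_ext_of_eval K (fun v => ?_) (fun v => ?_))
    · have h := congrArg (fun x : GL (Fin 2) ℝ => (x : Matrix (Fin 2) (Fin 2) ℝ)) (hgR v)
      simp only [Units.val_mul] at h
      rw [Units.val_mul, map_mul, hPR v, hKR v]
      exact h
    · have h := congrArg (fun x : GL (Fin 2) ℂ => (x : Matrix (Fin 2) (Fin 2) ℂ)) (hgC v)
      simp only [Units.val_mul] at h
      rw [Units.val_mul, map_mul, hPC v, hKC v]
      exact h

end Iwasawa

/-! ### 4. Vanishing Whittaker function forces `v = 0`; injectivity on `K_∞`-finite vectors -/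

section Injective

variable {hcpt : isCompact_glFiniteIntegralLevel 2 K}
  {E : Type*} [NormedAddCommGroup E] [InnerProductSpace ℂ E] [CompleteSpace E]
  {τ : ContRepresentation ℂ (AutomorphyDatum.gl 2 K hcpt).arch.carrier E}
  (hτ : τ.IsStronglyContinuous)

/-- `ℓ(τ(α) e) = ∫ α(h) ℓ(τ(h) e) dh` for a Gårding vector `e` (the functional passes through the
smoothing integral). [cite: JacquetShalikaAJM1981, §3, (3.1)–(3.3)] -/
theorem apply_archSmoothing_eq_integral_of_mem (hτu : τ.IsUnitary) {ℓ : archGardingSpace hcpt τ →ₗ[ℂ] ℂ}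
    (hℓW : IsArchContWhittakerFunctional hcpt τ hτ ℓ) {α : GL (Fin 2) (mixedSpace K) → ℂ} (hα : IsArchTestFunction 2 K α)
    (e : archGardingSpace hcpt τ) :
    ℓ ⟨archSmoothing hcpt τ α (e : E), archSmoothing_mem_archGardingSpace hα (e : E)⟩ =
      ∫ h, α h * ℓ (gardingAct hτ h e) ∂(archHaar 2 K) := by
  have hτb : ∀ g, ‖(τ g : E →L[ℂ] E)‖ ≤ 1 := fun g =>
    ContinuousLinearMap.opNorm_le_bound _ zero_le_one fun x => by rw [hτu.norm_map, one_mul]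
  set κ := tsupport α with hκ
  have hκc : IsCompact κ := hα.hasCompactSupport
  set ν : Measure (GL (Fin 2) (mixedSpace K)) := (archHaar 2 K).restrict κ with hν
  haveI : IsFiniteMeasure ν := ⟨by rw [Measure.restrict_apply_univ]; exact hκc.measure_lt_top⟩
  have hνκ : ∀ᵐ h ∂ν, h ∈ κ := ae_restrict_mem hκc.isClosed.measurableSet
  have hx : IsGardingContComb hcpt τ (fun h : GL (Fin 2) (mixedSpace K) => α h • (e : E)) :=
    (isGardingContComb_const e.2).smul hα.continuous
  -- the smoothing integral restricted to the support
  have heq : archSmoothing hcpt τ α (e : E) = ∫ h, τ (toArch hcpt h) (α h • (e : E)) ∂ν := by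
    have h2 : ∫ h, τ (toArch hcpt h) (α h • (e : E)) ∂ν = ∫ h, τ (toArch hcpt h) (α h • (e : E)) ∂(archHaar 2 K) := by
      rw [hν]
      exact setIntegral_eq_integral_of_forall_compl_eq_zero fun h hh => by
        rw [image_eq_zero_of_notMem_tsupport hh, zero_smul, map_zero]
    rw [h2]
    change ∫ h, α h • τ (toArch hcpt h) (e : E) ∂(archHaar 2 K) = _
    refine integral_congr_ae (Eventually.of_forall fun h => ?_)
    simp only [ContinuousLinearMap.map_smul]
  have hS : ∫ h, τ (toArch hcpt h) (α h • (e : E)) ∂ν ∈ archGardingSpace hcpt τ := by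
    rw [← heq]; exact archSmoothing_mem_archGardingSpace hα (e : E)
  have h1 : ℓ ⟨archSmoothing hcpt τ α (e : E), archSmoothing_mem_archGardingSpace hα (e : E)⟩ = ℓ ⟨∫ h, τ (toArch hcpt h) (α h • (e : E)) ∂ν, hS⟩ := by
    congr 1; exact Subtype.ext heq
  rw [h1, apply_integral_apply_toArch_eq_integral hτ hτb ν hκc hνκ hx hℓW.norm_le hS]
  -- back to the Haar integral
  have hval : ∀ h, ℓ ⟨τ (toArch hcpt h) (α h • (e : E)), apply_mem_archGardingSpace hτ _ (hx.mem h)⟩ = α h * ℓ (gardingAct hτ h e) := by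
    intro h
    rw [← smul_eq_mul, ← map_smul]
    congr 1
    exact Subtype.ext (by simp [coe_gardingAct_apply])
  simp_rw [hval]
  rw [hν]
  exact setIntegral_eq_integral_of_forall_compl_eq_zero fun h hh => by
    rw [image_eq_zero_of_notMem_tsupport hh, zero_mul]

/-- **A Gårding vector whose Whittaker function `g ↦ ℓ(τ(g) v)` vanishes identically is `0`** (`τ`
irreducible unitary, `ℓ ≠ 0` a continuous `ψ_∞`-Whittaker functional): the Riesz vectors `ξ_α`,
`⟪ξ_α, e⟫ = ℓ(τ(α) e)`, are orthogonal to the closed span of `τ(G_∞) v`, which is `E` unless `v = 0`.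
[cite: JacquetLanglands1970, §5–§6] [cite: Shalika1974, §3] -/
theorem eq_zero_of_forall_apply_gardingAct_eq_zero (hτu : τ.IsUnitary) (hτi : τ.IsTopIrreducible)
    {ℓ : archGardingSpace hcpt τ →ₗ[ℂ] ℂ} (hℓW : IsArchContWhittakerFunctional hcpt τ hτ ℓ) (hne : ℓ ≠ 0)
    {v : archGardingSpace hcpt τ} (hv : ∀ g : GL (Fin 2) (mixedSpace K), ℓ (gardingAct hτ g v) = 0) : v = 0 := by
  by_contra hv0
  -- the span of the orbit and its orthogonal complement
  set O : Submodule ℂ E := Submodule.span ℂ (Set.range fun g : GL (Fin 2) (mixedSpace K) => ((gardingAct hτ g v : archGardingSpace hcpt τ) : E)) with hO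
  have hOst : ∀ (g : (AutomorphyDatum.gl 2 K hcpt).arch.carrier), ∀ x ∈ O, τ g x ∈ O := by
    intro g x hx
    refine Submodule.span_induction (p := fun x _ => τ g x ∈ O) ?_ ?_ ?_ ?_ hx
    · rintro _ ⟨g', rfl⟩
      refine Submodule.subset_span ⟨(g : GL (Fin 2) (mixedSpace K)) * g', ?_⟩
      change ((gardingAct hτ ((g : GL (Fin 2) (mixedSpace K)) * g') v : archGardingSpace hcpt τ) : E) =
        τ g ((gardingAct hτ g' v : archGardingSpace hcpt τ) : E)
      rw [gardingAct_mul, Module.End.mul_apply, coe_gardingAct_apply]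
    · rw [map_zero]; exact Submodule.zero_mem _
    · intro x y _ _ hx hy; rw [map_add]; exact Submodule.add_mem _ hx hy
    · intro c x _ hx; rw [map_smul]; exact Submodule.smul_mem _ c hx
  have hMst : ∀ (g : (AutomorphyDatum.gl 2 K hcpt).arch.carrier), ∀ x ∈ Oᗮ, τ g x ∈ Oᗮ := by
    intro g x hx
    rw [Submodule.mem_orthogonal] at hx ⊢
    intro u hu
    have h1 : ⟪u, τ g x⟫_ℂ = ⟪τ g⁻¹ u, x⟫_ℂ := by
      rw [← hτu.inner_map_map g⁻¹ u (τ g x), ← ContinuousLinearMap.comp_apply]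
      have e : (τ g⁻¹).comp (τ g) = 1 := by
        rw [← ContinuousLinearMap.mul_def, ← map_mul, inv_mul_cancel, map_one]
      rw [e, one_apply_eq_self]
    rw [h1]
    exact hx _ (hOst _ u hu)
  -- `Oᗮ` as a closed subrepresentation; it is not `⊤` (it misses `v`), hence `⊥`
  let W : ContRepresentation.ClosedSubrep τ :=
    { toSubmodule := Oᗮ
      apply_mem_toSubmodule := fun g x hx => hMst g x hx
      isClosed' := Submodule.isClosed_orthogonal O }
  have hvO : ((v : archGardingSpace hcpt τ) : E) ∈ O := by
    refine Submodule.subset_span ⟨1, ?_⟩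
    change ((gardingAct hτ 1 v : archGardingSpace hcpt τ) : E) = v
    rw [gardingAct_one, Module.End.one_apply]
  have hWtop : W ≠ ⊤ := by
    intro h
    have hvW : ((v : archGardingSpace hcpt τ) : E) ∈ W := by rw [h]; exact ContRepresentation.ClosedSubrep.mem_top _
    have h0 : ⟪((v : archGardingSpace hcpt τ) : E), ((v : archGardingSpace hcpt τ) : E)⟫_ℂ = 0 :=
      Submodule.inner_right_of_mem_orthogonal hvO hvW
    exact hv0 (Subtype.ext (inner_self_eq_zero.1 h0))
  have hWbot : W = ⊥ := ((ContRepresentation.isTopIrreducible_iff τ).1 hτi).2 W |>.resolve_right hWtop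
  -- every Riesz vector lies in `Oᗮ = ⊥`
  obtain ⟨α, hα, hξ⟩ := hℓW.exists_whittakerRieszVector_ne_zero hτu hne
  refine hξ ?_
  have hξW : whittakerRieszVector hcpt τ hτ ℓ α ∈ W := by
    change whittakerRieszVector hcpt τ hτ ℓ α ∈ Oᗮ
    rw [Submodule.mem_orthogonal']
    intro u hu
    refine Submodule.span_induction (p := fun u _ => ⟪whittakerRieszVector hcpt τ hτ ℓ α, u⟫_ℂ = 0) ?_ ?_ ?_ ?_ hu
    · rintro _ ⟨g, rfl⟩
      rw [inner_whittakerRieszVector hℓW hτu hα]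
      have h := apply_archSmoothing_eq_integral_of_mem hτ hτu hℓW hα (gardingAct hτ g v)
      rw [h]
      refine integral_eq_zero_of_ae (Eventually.of_forall fun h' => ?_)
      change α h' * ℓ (gardingAct hτ h' (gardingAct hτ g v)) = 0
      rw [← Module.End.mul_apply, ← gardingAct_mul, hv, mul_zero]
    · exact inner_zero_right _
    · intro x y _ _ hx hy; rw [inner_add_right, hx, hy, add_zero]
    · intro c x _ hx; rw [inner_smul_right, hx, mul_zero]
  rw [hWbot] at hξW
  exact (ContRepresentation.ClosedSubrep.mem_bot).1 hξW

/-- **The Kirillov map is injective on `K_∞`-finite vectors**: for `τ` irreducible unitary, `ℓ ≠ 0` a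
continuous `ψ_∞`-Whittaker functional, `V` a finite-dimensional `K_∞`-stable subspace of the Gårding space
and `v ∈ V` with `ℓ(τ(diag(u,1)) v) = 0` for all `u ∈ K_∞ˣ`, one has `v = 0`.
[cite: JacquetLanglands1970, §5–§6] -/
theorem eq_zero_of_kFinite_of_mem_kirillovNull (hτu : τ.IsUnitary) (hτi : τ.IsTopIrreducible)
    {ℓ : archGardingSpace hcpt τ →ₗ[ℂ] ℂ} (hℓW : IsArchContWhittakerFunctional hcpt τ hτ ℓ) (hne : ℓ ≠ 0)
    {V : Submodule ℂ (archGardingSpace hcpt τ)} [FiniteDimensional ℂ V]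
    (hK : ∀ κ ∈ Kinf 2 K, ∀ u ∈ V, gardingAct hτ κ u ∈ V)
    {v : archGardingSpace hcpt τ} (hvV : v ∈ V) (hvS : v ∈ kirillovNull hτ ℓ) : v = 0 := by
  refine eq_zero_of_forall_apply_gardingAct_eq_zero hτ hτu hτi hℓW hne fun g => ?_
  obtain ⟨p, κ, hp, hκ, rfl⟩ := exists_borel_mul_Kinf (K := K) g
  rw [gardingAct_mul, Module.End.mul_apply]
  have h1 := kirillovNull_inf_kStable hτ hτu hτi hℓW hK hκ ⟨hvS, hvV⟩
  exact apply_eq_zero_of_mem_kirillovNull hτ ℓ (gardingAct_borel_mem_kirillovNull hτ hτu hτi hℓW hp h1.1)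

end Injective

end Literature.NumberTheory.Automorphic
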